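/-
Origin: expansion seat `planner-pub-hodgecm-mc-sanity-1-g2-0`, handover #5 2026-08-18T21:58Z md5 55f88cbc857e8f854a6b44368b0809f8 RESTAGED (supersedes a063659377b6 of 21:52Z and c80a6907d494 of 21:46Z: + §0 `smul_mem_thetaClasses` / `smul_mem_of_eq_thetaClasses` (theta classes are scalar-closed ⇒ hΘ is kernel for a Θ_k defined as theta classes), `classSupplyPack_hypothesis_iff … ↔ T.Open_supply` literal; NEW, 276 l., 15 decls; FINAL-NAMES rehearsal rc 0 / 7 s / 0 warn (`HOME/mc/pub-hodgecm-mc-sanity-1-g2/lean/ClassSupplySanity.lean`, md5 55f88cbc, 276 lines);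
landed by the packager successor (mc-unitary-1-g3, gen-8 kit) in gate run 32 as `HodgeCM/Model/Sanity/ClassSupplySanity.lean` (stripped 5 #print/#check/#eval lines).
-/
import Summits.HodgeConjecture.HodgeCM.Model.SupplyDischarge
import Summits.HodgeConjecture.HodgeCM.Model.Sanity.SupplyPairSanity

/-
Copyright: pub-hodgecm MODEL-CONSTRUCTION cell, 2026-08-18. Seat planner-pub-hodgecm-mc-sanity-1-g2-0 (node SAN-4 (c⁺⁺):
degenerate-instance sanity of the CLASS-level supply record, OFF the E path). KERNEL ONLY: 0 records cited,
0 hypotheses minted, 0 proof holes.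

# Sanity rows for `ClassSupplyData` / `ClassSupplyPack` (theta-3-g2 `Model/SupplyDischarge.lean`, md5 a456dbebab96)

Intended install path `HodgeCM/Model/Sanity/ClassSupplySanity.lean` (additive leaf; imports the file it tests and
`Sanity/SupplyPairSanity.lean`).

QUESTION (payload SAN duty, class level; the owner CONFIRMED the reading, STATUS 21:42:08Z, and asked for the
kernel row): `WeilPairData.ClassSupplyData P T V c k` names the class-level slots of node J-W7a — `K`-type
bookkeeping `(Kc, κ, E, σ, W, τ, ι)`, archimedean component `(G₁, K₁, ιinf, Δ, κ₁, τ₁, η₁)` with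
`IsLevelCorrected` / `IsWeightMatched`, a level `Γ₀`, a CLASS-MAP DATUM `D = (H10, pull, Hol, descends)` into
`H¹(Γ₀∖𝔹², ℂ)` of the model universe, generating sets `𝓙`, `𝓕`, and the properties `fam`, `char_mem`, `hol`,
`theta_sub` — all as FREE fields.  Which of them force the honest datum?

ANSWER (kernel-checked): NONE except `theta_sub`'s right-hand side.  For EVERY pair datum `P` (honest or not),
every level `Γ₀` and every class `c₀ ≠ 0` with `ℂ∙c₀ ⊆ T.Theta V c k Γ₀`,
`classSupplyDataOfLine P Γ₀ c₀ hc₀ hline : P.ClassSupplyData T V c k` — all groups trivial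
(`Kc = G₁ = K₁ := Unit`, `κ = ιinf = κ₁ = η₁ := 1`, `Δ := ⊤`), `E = W := ℂ` with trivial `σ`, `τ`, `τ₁`,
`ι := ` evaluation at `1`, `𝓙 = 𝓕 := univ` (the family `z ↦ z • φ_N` is theta-equivariant for the trivial
`K`-type, which gives `fam`), and the class-map datum `H10 := ℂ∙c₀`, `Hol := ⊤`,
`pull := (coordinate on ℂ∙c₀) • (constant form 1 on G₁ = Unit)`, whose `descends` is the surjectivity of
`pull` onto the ONE-dimensional space of weight forms on the trivial group; `hol` is membership in `⊤`, and
`theta_sub` reduces to `thetaClasses ⊆ H10 = ℂ∙c₀ ⊆ Θ_k(Γ₀)` (tree `thetaClasses_subset`).  Hence, for a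
scalar-closed `Θ_k` (`hΘ`; KERNEL for the assembler's intended `Θ_k(Γ) := thetaClasses ιinf D (thetaForms 𝓙 𝓕)`
by `smul_mem_thetaClasses` / `smul_mem_of_eq_thetaClasses`, § 0),
`Nonempty (P.ClassSupplyData T V c k) ↔ ∃ Γ, ∃ ω ∈ T.Theta V c k Γ, ω ≠ 0` (`nonempty_classSupplyData_iff`;
`→` is the owner's `ClassSupplyData.supply`), and the same for `ClassSupplyPack` over the trivial pair datum
(`nonempty_classSupplyPack_iff`), so the hypothesis of `open_supply_of_classSupplyPack` is EQUIVALENT to its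
conclusion `T.Open_supply` (`classSupplyPack_hypothesis_iff`).
READING (agreed with the owner): the record NAMES the slots; content enters only when `D` is the universe's own
class-map datum (node D3-geom) and `Θ_k` is DEFINED as its theta classes BY NAME — then `hol` (W6b-hol) and the
scalar non-vanishing become load-bearing.  Until then no field of `ClassSupplyData` certifies anything.
-/

set_option autoImplicit false

noncomputable section

open MeasureTheory NumberField NumberField.mixedEmbedding
open Literature.NumberTheory.Automorphic Literature.NumberTheory.Automorphic.WeightForms
open Literature.NumberTheory.Weil1964
open HodgeCM.PerL34.SupplyAdelic HodgeCM.Model.SupplyInstance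
open scoped SchwartzMap Classical

namespace HodgeCM
namespace Model
namespace SupplyResidual

/-! ### § 0. Theta classes are scalar-closed (discharges `hΘ` below for the assembler's intended `Θ_k`) -/

section ThetaClassesSmul

variable {GU : Type*} [Group GU] {G₁ : Type*} [Group G₁]
variable {Kc : Type*} [Group Kc] {K₁ : Type*} [Group K₁]
variable {W : Type*} [AddCommGroup W] [Module ℂ W]
variable {ΓU : Subgroup GU} {κ : Kc →* GU} {τ : Representation ℂ Kc W}
variable (ι : G₁ →* GU) {Δ : Subgroup G₁} {κ₁ : K₁ →* G₁} {τ₁ : Representation ℂ K₁ W}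
variable {hΔ : IsLevelCorrected ΓU κ τ ι Δ} {η₁ : K₁ →* Kc} {hη : IsWeightMatched κ τ ι κ₁ τ₁ η₁}
variable {H : Type*} [AddCommGroup H] [Module ℂ H]

/-- The theta classes of ANY class-map datum and ANY space of adelic forms are closed under scalars
(`pull` and `restrictHom` are linear, `H10`, `Hol`, `Θ` are submodules). -/
theorem smul_mem_thetaClasses (D : ClassMapDatum ι hΔ hη H) (Θ : Submodule ℂ (weightForms ΓU κ τ)) (z : ℂ)
    {h : H} (hh : h ∈ thetaClasses ι D Θ) : z • h ∈ thetaClasses ι D Θ := by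
  obtain ⟨c, rfl, F, hF, hHol, hpull⟩ := hh
  exact ⟨z • c, by simp, z • F, Θ.smul_mem z hF, by rw [map_smul]; exact D.Hol.smul_mem z hHol,
    by rw [map_smul, map_smul, hpull]⟩

/-- Hence a `Θ_k` DEFINED levelwise as theta classes satisfies the scalar-closedness hypothesis `hΘ` of the
`iff`s below. -/
theorem smul_mem_of_eq_thetaClasses (D : ClassMapDatum ι hΔ hη H) (Θ : Submodule ℂ (weightForms ΓU κ τ))
    {S : Set H} (hS : S = thetaClasses ι D Θ) (z : ℂ) {h : H} (hh : h ∈ S) : z • h ∈ S := by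
  subst hS
  exact smul_mem_thetaClasses ι D Θ z hh

end ThetaClassesSmul

/-! ### § 1. Weight forms on the trivial group -/

section UnitForms

/-- The constant function `1` is a weight form on the trivial group for the trivial weight. -/
def unitForm : weightForms (⊤ : Subgroup Unit) (1 : Unit →* Unit) (Representation.trivial ℂ Unit ℂ) :=
  ⟨fun _ => 1, fun _ _ _ => rfl, fun _ _ => by simp⟩

/-- (Ported verbatim from the HodgeCMPerL package; no docstring in the source.) -/
@[simp] theorem unitForm_apply (u : Unit) : (unitForm : Unit → ℂ) u = 1 := rfl

/-- Every weight form on the trivial group is a multiple of `unitForm`. -/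
theorem smul_unitForm_eq (f : weightForms (⊤ : Subgroup Unit) (1 : Unit →* Unit) (Representation.trivial ℂ Unit ℂ)) :
    (f : Unit → ℂ) () • unitForm = f := by
  refine Subtype.ext (funext fun u => ?_)
  rcases u with ⟨⟩
  simp [Pi.smul_apply, smul_eq_mul]

variable {GU : Type} [Group GU]

/-- Level correction for the trivial archimedean component: `1 · 1 ∈ Γ_U`. -/
theorem isLevelCorrected_unit (Γ : Subgroup GU) :
    IsLevelCorrected Γ (1 : Unit →* GU) (Representation.trivial ℂ Unit ℂ) (1 : Unit →* GU) ⊤ :=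
  fun _ _ => ⟨(), rfl, by simpa only [MonoidHom.one_apply, mul_one] using Γ.one_mem, fun _ => Commute.one_left _⟩

/-- Weight matching for the trivial weights. -/
theorem isWeightMatched_unit :
    IsWeightMatched (1 : Unit →* GU) (Representation.trivial ℂ Unit ℂ) (1 : Unit →* GU) (1 : Unit →* Unit)
      (Representation.trivial ℂ Unit ℂ) (1 : Unit →* Unit) :=
  ⟨fun _ => rfl, fun _ => rfl⟩

/-- **The degenerate class-map datum through the line `ℂ∙c₀`**: `H10 := ℂ∙c₀`, `Hol := ⊤`,
`pull := coordinate • unitForm`; DESCENT is the surjectivity of `pull` onto the line of weight forms on `Unit`. -/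
def lineClassMapDatum (Γ : Subgroup GU) {H : Type*} [AddCommGroup H] [Module ℂ H] (c₀ : H) (hc₀ : c₀ ≠ 0) :
    ClassMapDatum (1 : Unit →* GU) (isLevelCorrected_unit Γ) isWeightMatched_unit H where
  H10 := ℂ ∙ c₀
  pull := (LinearMap.toSpanSingleton ℂ _ unitForm).comp (LinearEquiv.coord ℂ H c₀ hc₀).toLinearMap
  Hol := ⊤
  descends f _ := by
    refine ⟨LinearEquiv.toSpanNonzeroSingleton ℂ H c₀ hc₀ ((f : Unit → ℂ) ()), ?_⟩
    rw [LinearMap.comp_apply, LinearEquiv.coe_toLinearMap, LinearEquiv.coord, LinearEquiv.symm_apply_apply,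
      LinearMap.toSpanSingleton_apply, smul_unitForm_eq]

/-- The theta classes of the degenerate datum lie on the line `ℂ∙c₀`. -/
theorem exists_smul_eq_of_mem_thetaClasses_line (Γ : Subgroup GU) {H : Type*} [AddCommGroup H] [Module ℂ H]
    (c₀ : H) (hc₀ : c₀ ≠ 0) (Θ : Submodule ℂ (weightForms Γ (1 : Unit →* GU) (Representation.trivial ℂ Unit ℂ)))
    {h : H} (hh : h ∈ thetaClasses (1 : Unit →* GU) (lineClassMapDatum Γ c₀ hc₀) Θ) : ∃ z : ℂ, z • c₀ = h :=
  Submodule.mem_span_singleton.mp (thetaClasses_subset (1 : Unit →* GU) (lineClassMapDatum Γ c₀ hc₀) Θ hh)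

end UnitForms

/-! ### § 2. The degenerate class-level datum over ANY pair datum -/

namespace WeilPairData

variable {K L : Type} [Field K] [NumberField K] [Field L] [NumberField L] [Algebra K L] [FiniteDimensional K L]
variable {J : Type} [Fintype J] {GU : Type} [Group GU] [TopologicalSpace GU] [IsTopologicalGroup GU]
  [LocallyCompactSpace GU] (P : WeilPairData K L J GU) [CompactSpace (GU ⧸ P.ΓU)]
variable {U : Universe} (T : U.ThetaModel) {Lc : CMField} {ι₁ : Lc →+* ℂ} (V : HermSpace3 Lc ι₁) (c : SeesawCtx Lc)
  (k : Fin 4)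

omit [CompactSpace (GU ⧸ P.ΓU)] in
/-- The test family `z ↦ z • φ_N` for the trivial `K`-type is theta-equivariant. -/
theorem isThetaEquivariant_toSpanSingleton (Φ : P.weilDatum.ThetaTop) :
    P.kernelDatum.IsThetaEquivariant (1 : Unit →* GU) (Representation.trivial ℂ Unit ℂ)
      (LinearMap.toSpanSingleton ℂ P.weilDatum.ThetaTop Φ) := by
  intro u z S
  simp only [Representation.trivial_apply, MonoidHom.one_apply, Prod.mk_one_one, map_one, mul_one]

/-- **`ClassSupplyData` over ANY pair datum from one line in `Θ_k(Γ₀)`**: all groups trivial, all weights trivial,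
`𝓙 = 𝓕 := univ`, class-map datum `lineClassMapDatum Γ_U c₀`.  `fam` is `1 • φ_N = φ_N`, `char_mem` and `hol` are
membership in `univ` / `⊤`, `theta_sub` is `thetaClasses ⊆ ℂ∙c₀ ⊆ Θ_k(Γ₀)`. -/
def classSupplyDataOfLine (Γ₀ : Level V) (c₀ : U.CohC (U.pms Lc ι₁ V Γ₀) 1) (hc₀ : c₀ ≠ 0)
    (hline : ∀ z : ℂ, z • c₀ ∈ T.Theta V c k Γ₀) : P.ClassSupplyData T V c k where
  Kc := Unit
  instKc := inferInstance
  κ := 1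
  E := ℂ
  instE := inferInstance
  instEm := inferInstance
  σ := Representation.trivial ℂ Unit ℂ
  W := ℂ
  instW := inferInstance
  instWm := inferInstance
  instWr := inferInstance
  τ := Representation.trivial ℂ Unit ℂ
  ι := LinearMap.applyₗ (1 : ℂ)
  hι u ℓ := by
    rw [Representation.dual_apply, Module.Dual.transpose_apply, Representation.trivial_apply]
    rfl
  G₁ := Unit
  instG₁ := inferInstance
  K₁ := Unit
  instK₁ := inferInstance
  ιinf := 1
  Δ := ⊤
  κ₁ := 1
  τ₁ := Representation.trivial ℂ Unit ℂ
  η₁ := 1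
  hΔ := isLevelCorrected_unit P.ΓU
  hη := isWeightMatched_unit
  Γ₀ := Γ₀
  D := lineClassMapDatum P.ΓU c₀ hc₀
  𝓙 := Set.univ
  𝓕 := Set.univ
  fam N _ := ⟨⟨LinearMap.toSpanSingleton ℂ _ (P.testFunT N), P.isThetaEquivariant_toSpanSingleton _⟩,
    Set.mem_univ _, LinearMap.id, by simp⟩
  char_mem _ _ := Set.mem_univ _
  hol _ _ _ _ := Submodule.mem_top
  theta_sub h hh := by
    obtain ⟨z, rfl⟩ := exists_smul_eq_of_mem_thetaClasses_line P.ΓU c₀ hc₀ _ hh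
    exact hline z

/-- **The class-level record is exactly as strong as its output** for a scalar-closed `Θ_k`:
`Nonempty (P.ClassSupplyData T V c k) ↔ ∃ Γ, ∃ ω ∈ T.Theta V c k Γ, ω ≠ 0` — for EVERY pair datum `P`.
(`→` is the owner's `ClassSupplyData.supply`; `←` is `classSupplyDataOfLine`.) -/
theorem nonempty_classSupplyData_iff
    (hΘ : ∀ (Γ : Level V) (z : ℂ) (ω : U.CohC (U.pms Lc ι₁ V Γ) 1), ω ∈ T.Theta V c k Γ → z • ω ∈ T.Theta V c k Γ) :
    Nonempty (P.ClassSupplyData T V c k) ↔ ∃ Γ : Level V, ∃ ω ∈ T.Theta V c k Γ, ω ≠ 0 :=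
  ⟨fun ⟨S⟩ => S.supply, fun ⟨Γ, ω, hω, hne⟩ =>
    ⟨P.classSupplyDataOfLine T V c k Γ ω hne fun z => hΘ Γ z ω hω⟩⟩

end WeilPairData

/-! ### § 3. The class supply pack over the trivial pair datum -/

section Pack

variable {K : Type} [Field K] [NumberField K] {J : Type} [Fintype J]
variable {U : Universe} (T : U.ThetaModel) {Lc : CMField} {ι₁ : Lc →+* ℂ} (V : HermSpace3 Lc ι₁) (c : SeesawCtx Lc)
  (k : Fin 4)

/-- **`ClassSupplyPack` from one line in `Θ_k(Γ₀)`**: carriers `L := K`, `G_U := Unit`, the trivial pair datum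
of `Sanity/SupplyPairSanity`, and the degenerate class-level datum. -/
def classSupplyPackOfLine (Φinf : 𝓢((J → mixedSpace K), ℂ)) (x₀ : J → K) (hx₀ : Φinf (archEmb K J x₀) ≠ 0)
    (Γ₀ : Level V) (c₀ : U.CohC (U.pms Lc ι₁ V Γ₀) 1) (hc₀ : c₀ ≠ 0)
    (hline : ∀ z : ℂ, z • c₀ ∈ T.Theta V c k Γ₀) : ClassSupplyPack T V c k where
  K := K
  L := K
  instK := inferInstance
  instKnf := inferInstance
  instL := inferInstance
  instLnf := inferInstance
  instAlg := inferInstance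
  instFD := inferInstance
  J := J
  instJ := inferInstance
  GU := Unit
  instGU := inferInstance
  instGUtop := inferInstance
  instGUtg := inferInstance
  instGUlc := inferInstance
  P := trivialPairData K K J Unit Φinf x₀ hx₀
  instCompact := compactSpace_quotient_top
  cls := (trivialPairData K K J Unit Φinf x₀ hx₀).classSupplyDataOfLine T V c k Γ₀ c₀ hc₀ hline

/-- **The class supply pack is exactly as strong as its output** (scalar-closed `Θ_k`, one archimedean test
function non-vanishing at a rational point). -/
theorem nonempty_classSupplyPack_iff (Φinf : 𝓢((J → mixedSpace K), ℂ)) (x₀ : J → K)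
    (hx₀ : Φinf (archEmb K J x₀) ≠ 0)
    (hΘ : ∀ (Γ : Level V) (z : ℂ) (ω : U.CohC (U.pms Lc ι₁ V Γ) 1), ω ∈ T.Theta V c k Γ → z • ω ∈ T.Theta V c k Γ) :
    Nonempty (ClassSupplyPack T V c k) ↔ ∃ Γ : Level V, ∃ ω ∈ T.Theta V c k Γ, ω ≠ 0 :=
  ⟨fun ⟨S⟩ => S.cls.supply, fun ⟨Γ, ω, hω, hne⟩ =>
    ⟨classSupplyPackOfLine T V c k Φinf x₀ hx₀ Γ ω hne fun z => hΘ Γ z ω hω⟩⟩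

/-- Hence the hypothesis of `open_supply_of_classSupplyPack` is EQUIVALENT to its conclusion `T.Open_supply` (for a
model whose `Θ₀`, `Θ₁` are scalar-closed): the class supply pack, with `D` and `Θ_k` free, transports supply and
certifies none. -/
theorem classSupplyPack_hypothesis_iff (Φinf : 𝓢((J → mixedSpace K), ℂ)) (x₀ : J → K)
    (hx₀ : Φinf (archEmb K J x₀) ≠ 0)
    (hΘ : ∀ {Lc : CMField} {ι₁ : Lc →+* ℂ} (V : HermSpace3 Lc ι₁) (c : SeesawCtx Lc) (k : Fin 4) (Γ : Level V)
      (z : ℂ) (ω : U.CohC (U.pms Lc ι₁ V Γ) 1), ω ∈ T.Theta V c k Γ → z • ω ∈ T.Theta V c k Γ) :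
    (∀ {Lc : CMField} {ι₁ : Lc →+* ℂ} (V : HermSpace3 Lc ι₁) (c : SeesawCtx Lc), T.GoodCtx ι₁ c →
        Nonempty (ClassSupplyPack T V c 0) ∧ Nonempty (ClassSupplyPack T V c 1)) ↔ T.Open_supply := by
  refine ⟨fun H Lc ι₁ V c hc => ?_, fun H Lc ι₁ V c hc => ?_⟩
  · exact ⟨(nonempty_classSupplyPack_iff T V c 0 Φinf x₀ hx₀ (hΘ V c 0)).mp (H V c hc).1,
      (nonempty_classSupplyPack_iff T V c 1 Φinf x₀ hx₀ (hΘ V c 1)).mp (H V c hc).2⟩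
  · exact ⟨(nonempty_classSupplyPack_iff T V c 0 Φinf x₀ hx₀ (hΘ V c 0)).mpr (H V c hc).1,
      (nonempty_classSupplyPack_iff T V c 1 Φinf x₀ hx₀ (hΘ V c 1)).mpr (H V c hc).2⟩

end Pack

end SupplyResidual
end Model
end HodgeCM

end

/-! ## Axiom audit (expected: `propext`, `Classical.choice`, `Quot.sound` only) -/
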